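import Literature.Computability.AlgebraicComplexity.HamiltonianCycleVNP
import Literature.Computability.AlgebraicComplexity.ValiantClassesProofs
import HarnessLib

/-!
# The Hamiltonian cycle family is monotone: `HC_n` is a projection of `HC_{n'}` for `n ≤ n'`

Topic `Computability/AlgebraicComplexity`; companion of `PermanentMonotone.lean` (`per_m ≤_p per_{m'}`).
The standard padding of the Hamiltonian cycle polynomial `HC_n = ∑_{π an n-cycle} ∏ᵢ X_{π i, i}`
(Bürgisser 2000, (2.3)) is NOT block-diagonal (a Hamiltonian cycle must visit the new vertex) but
EDGE SUBDIVISION: to pass from `n` to `n + 1` vertices, insert the new vertex `ν` on every arc into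
the old vertex `0` — i.e. substitute, in `HC_{n+1}` on the vertex set `{ν} ∪ {old}` (`ν = 0`,
old `a ↦ a.succ`), `X_{1, ν} ↦ 1` (the only arc out of `ν` goes to old `0`), `X_{ν, b.succ} ↦ X_{0, b}`
(an old arc `b → 0` now enters `ν`), `X_{1, b.succ} ↦ 0` (nothing else enters old `0`),
`X_{a.succ, b.succ} ↦ X_{a, b}` (`a ≠ 0`), all other variables `↦ 0`. Hamiltonian cycles of the
subdivided digraph correspond bijectively to Hamiltonian cycles of the old one, with equal weights.
In the tree's parametrisation of `n`-cycles by vertex orderings starting at `0`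
(`hamiltonianCycleSum_eq_sum_orderings`, BCS 1997 Prop. (21.15)) the bijection is Mathlib's
`Equiv.Perm.decomposeFin`: the new ordering is `ν` followed by the old ordering.

Proved here (no definitions): `hamiltonianCycleSum_subdivide` (the combinatorial identity over any
commutative semiring), `isProjection_hcPoly_succ`, `isProjection_hcPoly_of_le`
(`HC_n ≤_proj HC_{n'}` for `n ≤ n'`, a Valiant projection, Bürgisser 2000 Def. 2.6),
`complexity_hcPoly_mono`. Standard material (the vertex-insertion reduction between Hamiltonian
cycle problems of different sizes is folklore; Bürgisser 2000 §2.1, §3.3 uses that the complete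
families are closed under such paddings); recorded because the tree had the permanent's padding only.

## References

* [Burgisser2000] P. Bürgisser, *Completeness and Reduction in Algebraic Complexity Theory*,
  Springer 2000, (2.3) (`HC_n`), Def. 2.6 and Rem. 2.7 (projections), §2.1.
* [BurgisserClausenShokrollahi1997] P. Bürgisser, M. Clausen, M. A. Shokrollahi, *Algebraic
  Complexity Theory*, Springer 1997, Prop. (21.15) (cycles as orderings).
* [Valiant1979] L. G. Valiant, *Completeness classes in algebra*, STOC 1979.
-/

noncomputable section

namespace Literature.Computability.AlgebraicComplexity

open MvPolynomial Matrix Equiv Finset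

/-! ### The combinatorial identity: subdividing the arcs into one vertex -/

section Subdivide

variable {R : Type*} [CommSemiring R] {m : ℕ}

/-- `finRotate` on `Fin (m+3)` maps `0` to `1`. [folklore] -/
private theorem finRotate_zero_eq_one : finRotate (m + 3) 0 = 1 := by
  rw [finRotate_succ_eq_decomposeFin, Equiv.Perm.decomposeFin_symm_apply_zero]

/-- Away from the last position, rotating after `Fin.succ` is `Fin.succ` after rotating.
[folklore] -/
private theorem finRotate_succ_of_ne_last {s : Fin (m + 2)} (hs : s ≠ Fin.last (m + 1)) :
    finRotate (m + 3) s.succ = (finRotate (m + 2) s).succ := by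
  rw [finRotate_succ_eq_decomposeFin, Equiv.Perm.decomposeFin_symm_apply_succ]
  apply Equiv.swap_apply_of_ne_of_ne
  · exact Fin.succ_ne_zero _
  · intro h
    rw [← Fin.succ_zero_eq_one, Fin.succ_inj] at h
    exact hs ((finRotate (m + 2)).injective (h.trans finRotate_last.symm))

/-- `finRotate` on `Fin (m+2)` vanishes only at the last position. [folklore] -/
private theorem finRotate_ne_zero_of_ne_last {s : Fin (m + 2)} (hs : s ≠ Fin.last (m + 1)) :
    finRotate (m + 2) s ≠ 0 := fun h =>
  hs ((finRotate (m + 2)).injective (h.trans finRotate_last.symm))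

/-- **Subdivision identity for the Hamiltonian cycle sum.** For an `(m+2) × (m+2)` matrix `M`
(arc `b → a` weighted `M a b`), let `B` be the `(m+3) × (m+3)` matrix of the digraph obtained by
inserting the vertex `0` on every arc into the old vertex `0` (old vertices shifted by `Fin.succ`):
`B x 0 = [x = 1]`, `B 0 b.succ = M 0 b`, `B 1 b.succ = 0`, `B a.succ b.succ = M a b` (`a ≠ 0`).
Then `HC(B) = HC(M)`. Proof: write both sides as sums over vertex orderings starting at `0`
(`hamiltonianCycleSum_eq_sum_orderings`); an ordering of the new vertex set contributes only if
its second vertex is `1` (the arc out of the new vertex), i.e. it is `decomposeFin.symm (0, σ)`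
for an old ordering `σ` starting at `0`, and then the weights agree factor by factor.
[cite: BurgisserClausenShokrollahi1997, Prop. (21.15)] -/
theorem hamiltonianCycleSum_subdivide (M : Matrix (Fin (m + 2)) (Fin (m + 2)) R) :
    (Matrix.of fun x y : Fin (m + 3) =>
      Fin.cases (motive := fun _ => R) (if x = 1 then 1 else 0)
        (fun b => Fin.cases (motive := fun _ => R) (M 0 b) (fun a => if a = 0 then 0 else M a b) x)
        y).hamiltonianCycleSum = M.hamiltonianCycleSum := by
  set B : Matrix (Fin (m + 3)) (Fin (m + 3)) R := Matrix.of fun x y : Fin (m + 3) =>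
      Fin.cases (motive := fun _ => R) (if x = 1 then 1 else 0)
        (fun b => Fin.cases (motive := fun _ => R) (M 0 b) (fun a => if a = 0 then 0 else M a b) x)
        y with hB
  have hB0 : ∀ x : Fin (m + 3), B x 0 = if x = 1 then 1 else 0 := fun x => by
    simp [hB, Matrix.of_apply]
  have hB0s : ∀ b : Fin (m + 2), B 0 b.succ = M 0 b := fun b => by
    simp [hB, Matrix.of_apply]
  have hBss : ∀ a b : Fin (m + 2), B a.succ b.succ = if a = 0 then 0 else M a b := fun a b => by
    simp [hB, Matrix.of_apply]
  rw [hamiltonianCycleSum_eq_sum_orderings B, hamiltonianCycleSum_eq_sum_orderings M,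
    Finset.sum_filter, Finset.sum_filter, Finset.univ_perm_fin_succ, Finset.sum_map,
    ← Finset.univ_product_univ, Finset.sum_product, Finset.sum_comm]
  simp only [Equiv.toEmbedding_apply, Equiv.Perm.decomposeFin_symm_apply_zero,
    Finset.sum_ite_eq', Finset.mem_univ, if_true]
  refine Finset.sum_congr rfl fun σ _ => ?_
  -- the ordering `ν, σ 0, σ 1, …` of the new vertex set
  set Φ : Perm (Fin (m + 3)) := Equiv.Perm.decomposeFin.symm (0, σ) with hΦ
  have hΦ0 : Φ 0 = 0 := Equiv.Perm.decomposeFin_symm_apply_zero 0 σ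
  have hΦs : ∀ x : Fin (m + 2), Φ x.succ = (σ x).succ := fun x => by
    rw [hΦ, Equiv.Perm.decomposeFin_symm_apply_succ, Equiv.swap_self, Equiv.refl_apply]
  rw [Fin.prod_univ_succ, finRotate_zero_eq_one, hΦ0, ← Fin.succ_zero_eq_one, hΦs, hB0]
  by_cases h0 : σ 0 = 0
  · -- second vertex is `1`: the weights agree factor by factor
    rw [if_pos (by rw [h0, Fin.succ_zero_eq_one]), if_pos h0, one_mul]
    refine Finset.prod_congr rfl fun s _ => ?_
    by_cases hs : s = Fin.last (m + 1)
    · subst hs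
      have e1 : finRotate (m + 3) (Fin.last (m + 1)).succ = 0 := by
        rw [Fin.succ_last]; exact finRotate_last
      rw [e1, hΦ0, hΦs, hB0s, finRotate_last, h0]
    · rw [finRotate_succ_of_ne_last hs, hΦs, hΦs, hBss,
        if_neg (fun h => finRotate_ne_zero_of_ne_last hs (σ.injective (h.trans h0.symm)))]
  · -- otherwise the arc out of the new vertex is missing
    rw [if_neg (fun h => h0 (Fin.succ_inj.mp (h.trans Fin.succ_zero_eq_one.symm))), if_neg h0,
      zero_mul]

end Subdivide

/-! ### `HC_n` is a projection of `HC_{n+1}` -/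

section Projection

variable (k : Type*) [CommSemiring k]

/-- Substituting polynomials into the generic Hamiltonian cycle polynomial gives the Hamiltonian
cycle sum of the substituted matrix. [cite: Burgisser2000, (2.3)] -/
theorem aeval_hcPoly_eq {n : ℕ} {τ : Type*} (s : Fin n × Fin n → MvPolynomial τ k) :
    aeval s (hcPoly (Fin n) k) = (Matrix.of fun x y : Fin n => s (x, y)).hamiltonianCycleSum := by
  simp [hcPoly, Matrix.hamiltonianCycleSum, map_sum, map_prod, mvPolynomialX_apply]

/-- `HC_n = 0` for `n ≤ 1` (no permutation of at most one point is an `n`-cycle: every part of a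
cycle type is `≥ 2`) — the tree's `hcPoly_fin_eq_zero_of_le_one` verbatim, but over a commutative
SEMIring (that lemma assumes a commutative ring); private copy to keep this file semiring-general.
[folklore] -/
private theorem hcPoly_eq_zero_of_le_one' {n : ℕ} (hn : n ≤ 1) : hcPoly (Fin n) k = 0 := by
  unfold hcPoly Matrix.hamiltonianCycleSum
  refine Finset.sum_eq_zero fun π hπ => ?_
  exfalso
  rw [Finset.mem_filter] at hπ
  have h2 := Equiv.Perm.two_le_of_mem_cycleType (σ := π) (n := Fintype.card (Fin n))
    (by rw [hπ.2]; exact Multiset.mem_singleton_self _)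
  rw [Fintype.card_fin] at h2
  omega

/-- The zero polynomial is a projection of `HC_{n+1}` (substitute `0` everywhere: every term of the
cycle sum has a factor). [cite: Burgisser2000, Def. 2.6] -/
theorem isProjection_zero_hcPoly_succ {τ : Type*} (n : ℕ) :
    IsProjection (0 : MvPolynomial τ k) (hcPoly (Fin (n + 1)) k) := by
  refine ⟨fun _ => C 0, fun _ => Or.inr ⟨0, rfl⟩, ?_⟩
  rw [aeval_hcPoly_eq]
  unfold Matrix.hamiltonianCycleSum
  symm
  refine Finset.sum_eq_zero fun π _ => Finset.prod_eq_zero (Finset.mem_univ (0 : Fin (n + 1))) ?_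
  simp

/-- **`HC_{m+2}` is a projection of `HC_{m+3}`** by the subdivision substitution of the module
docstring (all values variables `X_{a,b}` or constants `0`, `1`).
[cite: Burgisser2000, Def. 2.6] [cite: BurgisserClausenShokrollahi1997, Prop. (21.15)] -/
theorem isProjection_hcPoly_subdivide (m : ℕ) :
    IsProjection (hcPoly (Fin (m + 2)) k) (hcPoly (Fin (m + 3)) k) := by
  classical
  -- the subdivision substitution, read off the subdivided matrix of the generic matrix
  let B : Matrix (Fin (m + 3)) (Fin (m + 3)) (MvPolynomial (Fin (m + 2) × Fin (m + 2)) k) :=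
    Matrix.of fun x y : Fin (m + 3) =>
      Fin.cases (motive := fun _ => MvPolynomial (Fin (m + 2) × Fin (m + 2)) k)
        (if x = 1 then 1 else 0)
        (fun b => Fin.cases (motive := fun _ => MvPolynomial (Fin (m + 2) × Fin (m + 2)) k)
          (mvPolynomialX (Fin (m + 2)) (Fin (m + 2)) k 0 b)
          (fun a => if a = 0 then 0 else mvPolynomialX (Fin (m + 2)) (Fin (m + 2)) k a b) x) y
  refine ⟨fun xy => B xy.1 xy.2, fun xy => ?_, ?_⟩
  · -- every value is a variable or a constant
    obtain ⟨x, y⟩ := xy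
    simp only [B, Matrix.of_apply]
    refine Fin.cases ?_ (fun b => ?_) y
    · simp only [Fin.cases_zero]
      split_ifs
      · exact Or.inr ⟨1, C_1.symm⟩
      · exact Or.inr ⟨0, C_0.symm⟩
    · simp only [Fin.cases_succ]
      refine Fin.cases ?_ (fun a => ?_) x
      · simp only [Fin.cases_zero, mvPolynomialX_apply]
        exact Or.inl ⟨(0, b), rfl⟩
      · simp only [Fin.cases_succ, mvPolynomialX_apply]
        split_ifs
        · exact Or.inr ⟨0, C_0.symm⟩
        · exact Or.inl ⟨(a, b), rfl⟩
  · -- the substituted `HC_{m+3}` is `HC_{m+2}`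
    rw [aeval_hcPoly_eq]
    have hBof : (Matrix.of fun x y : Fin (m + 3) => B x y) = B := by ext x y; rfl
    rw [hBof]
    unfold hcPoly
    exact (hamiltonianCycleSum_subdivide (mvPolynomialX (Fin (m + 2)) (Fin (m + 2)) k)).symm

/-- **`HC_n` is a projection of `HC_{n+1}`** (`n = 0, 1`: `HC_n = 0`; `n ≥ 2`: subdivision).
[cite: Burgisser2000, Def. 2.6] -/
theorem isProjection_hcPoly_succ : ∀ n : ℕ, IsProjection (hcPoly (Fin n) k) (hcPoly (Fin (n + 1)) k)
  | 0 => by rw [hcPoly_eq_zero_of_le_one' k (Nat.zero_le 1)]; exact isProjection_zero_hcPoly_succ k 0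
  | 1 => by rw [hcPoly_eq_zero_of_le_one' k le_rfl]; exact isProjection_zero_hcPoly_succ k 1
  | m + 2 => isProjection_hcPoly_subdivide k m

/-- **`HC_n` is a projection of `HC_{n'}`** for `n ≤ n'` (iterate; projections compose,
`IsProjection.trans_holds`). [cite: Burgisser2000, Def. 2.6 and §2.1] -/
theorem isProjection_hcPoly_of_le {n n' : ℕ} (h : n ≤ n') :
    IsProjection (hcPoly (Fin n) k) (hcPoly (Fin n') k) := by
  induction h with
  | refl => exact IsProjection.refl _
  | step _ ih => exact IsProjection.trans_holds ih (isProjection_hcPoly_succ k _)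

/-- **Monotonicity of the complexity of the Hamiltonian cycle polynomial**: `L(HC_n) ≤ L(HC_{n'})`
for `n ≤ n'` (projections are free, `complexity_le_of_isProjection`).
[cite: Burgisser2000, Rem. 2.7] -/
theorem complexity_hcPoly_mono {n n' : ℕ} (h : n ≤ n') :
    complexity (hcPoly (Fin n) k) ≤ complexity (hcPoly (Fin n') k) :=
  complexity_le_of_isProjection (isProjection_hcPoly_of_le k h)

end Projection

end Literature.Computability.AlgebraicComplexity

end
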